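import Summits.BirchSwinnertonDyer.BirchSwinnertonDyer.Theorems.EisensteinPrimesMazurMCOnX1RankZeroInterludeRoadBLocalIndex
import Literature.NumberTheory.EllipticCurves.Castella2018.AnticyclotomicSelmer
import Literature.NumberTheory.EllipticCurves.GreenbergVatsal2000.GreenbergSelmerGroups
import Literature.NumberTheory.EllipticCurves.IsogenySelmerInfty
import Literature.NumberTheory.EllipticCurves.IsogenySelmerGroups
import Literature.NumberTheory.EllipticCurves.IsogenyGroundFieldExtension
import Literature.NumberTheory.EllipticCurves.IsogenyDualElliptic
import Literature.NumberTheory.EllipticCurves.IsogenyMulProofs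
import Literature.NumberTheory.EllipticCurves.SubgroupSelmerCocycleCriteriaProofs
import Literature.NumberTheory.EllipticCurves.SelmerCorankAssembly
import Literature.NumberTheory.EllipticCurves.IwasawaSelmerProofs
import Literature.NumberTheory.EllipticCurves.GoodReductionUnramifiedProofs
import Literature.NumberTheory.EllipticCurves.ZpExtensionInertiaTorsionCyclotomicProofs
import Literature.NumberTheory.GaloisRepresentations.DecompositionGroupOfCompletion
import HarnessLib

/-!
# Crux `MazurMCOnX1RankZero` (item stmt-BirchSwinnertonDyer-19035), line `interlude_with_torsion`, road B (B1c) at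
# degree exactly `p`, pieces (R1), (R2), (R3), (R4): the kernel module `W[ψ]` of a degree-`p` isogeny inside `W[p^∞]`

Cell `bsd-eis` (host `run/shared/lean/pub/bsd-eis/`), LEAD `cruxlead-19035` (g0), stub worker on the registered stub
`stub_roadBResidueP` of skeleton v8; `--supports` stmt-BirchSwinnertonDyer-19035 as a HELPER. Content = sections
KernelModule / Generator / LocalKernel of the companion workfile
`Cruxes/MazurMCOnX1RankZero/Lines/interlude_stepsTwoThree_split_idea11g6_roadB_helpers.lean` (rev 2, ideator bsd-idea-11
g16, sorry-free there), moved into the tree (blueprint: memo `Lines/interlude_K2mu_ArnoldKoo_memo_idea11g14.md` §10).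
UNCONDITIONAL Galois-cohomology bookkeeping; NOTHING is asserted about BSD, Mazur's main conjecture or IMC2.

Setting. `ψ : W → W'` an isogeny of degree `p` over a field `K`, `S` an ABSTRACT discrete `Γ_K`-module with an
injective equivariant map `ι : S → W[p^∞]` onto `ker ψ ∩ W[p^∞]` (hypotheses `hinj`, `hιψ`, `hsurj`), `ι_*` the induced
map on the tree's continuous `H¹` (`resH1Hom (id) ι`).
* `resOfLe_resH1Hom_id`, `resOfLe_resH1Hom_id_oneCocycleClass_eq_zero_iff` — `ι_*` commutes with restriction.
* **(R1)** `exists_resH1Hom_eq_of_h1Map_eq_zero` — a class of `H¹(H, W[p^∞])` killed by `ψ_*` is `ι_* d` (cocycle lift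
  through the surjection `ψ : W(K̄) → W'(K̄)`; `p · ker ψ = 0` since `#ker ψ = p`).
* **(R4)** `mem_unramifiedKer_of_resH1Hom_mem_awayKer` — at a place `u ∤ p` of good reduction, `ι_* d` locally trivial
  ⟹ `d` unramified (forward Néron–Ogg–Shafarevich, tree `smul_eq_of_mem_inertia_of_nsmul_eq_zero`).
* **(R2)** `exists_mem_decomp_inv_mul_mem_kerSubgroup` — `K` quadratic, `p = v v̄` split, `κ` cyclotomic ⟹
  `Γ_K = I_v̄ · ker κ` (tree `ZpExtension.exists_mem_inertia_cyclotomicCharacter_eq_of_split`): ONE place above `v̄`.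
* **(R3)** `finite_ker_resH1Hom_id` — for ANY `G₀ ≤ Γ_K`, `ker (ι_* : H¹(G₀, S) → H¹(G₀, W[p^∞]))` is finite: it is
  the image of `W'[p^∞]^{G₀}` under the connecting map (`connCocycle`), which factors through
  `W'[p^∞]^{G₀} / (ψ(W[p^∞]^{G₀}) ∩ W'[p^∞]^{G₀})`, of finite index by the landed (R3-alg)
  `RoadBHelpers.finiteIndex_map_inf_of_comp_eq_nsmul` (dual isogeny, `ψ̂ψ = [p]`, `W'[p]` finite). NO Imai, NO `μ`.
References: Greenberg, LNM 1716 §5 (proof of Prop. 5.10); Serre, Galois Cohomology I.§2.4, I.§5.4; Silverman AEC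
Thm. III.4.10, III.6.1, Prop. VII.4.1; Washington §13.1.
-/

set_option linter.dupNamespace false
set_option autoImplicit false

noncomputable section

open scoped Classical

namespace Summit.BirchSwinnertonDyer.BirchSwinnertonDyer.Theorems.InterludeWithTorsion.RoadBHelpers

open AddSubgroup Field Literature.NumberTheory.EllipticCurves Literature.NumberTheory.EllipticCurves.GreenbergSelmer
  Literature.NumberTheory.GaloisRepresentations NumberField IsDedekindDomain
  Literature.NumberTheory.EllipticCurves.IsogenySelmerInfty

universe u

/-! ## `ι_*` and restriction -/

section Cohomology

variable {G : Type u} [Group G] [TopologicalSpace G] [IsTopologicalGroup G]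
  {S : Type u} [AddCommGroup S] [DistribMulAction G S] [TopologicalSpace S] [DiscreteTopology S]
  {M : Type u} [AddCommGroup M] [DistribMulAction G M] [TopologicalSpace M] [DiscreteTopology M]

/-- `ι_*` commutes with restriction to a smaller subgroup. [cite: SerreGaloisCohomology1997, I.§2.4–2.5] -/
theorem resOfLe_resH1Hom_id {H₁ H₂ : Subgroup G} (hle : H₁ ≤ H₂) (ι : S →+ M)
    (hι : ∀ (g : G) (s : S), ι (g • s) = g • ι s) (d : subgroupH1 H₂ S) :
    resOfLe M hle (resH1Hom (ContinuousMonoidHom.id H₂) ι (fun x s ↦ hι x s) d) =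
      resH1Hom (ContinuousMonoidHom.id H₁) ι (fun x s ↦ hι x s) (resOfLe S hle d) := by
  change ((resOfLe M hle).comp (resH1Hom (ContinuousMonoidHom.id H₂) ι (fun x s ↦ hι x s))) d =
    ((resH1Hom (ContinuousMonoidHom.id H₁) ι (fun x s ↦ hι x s)).comp (resOfLe S hle)) d
  unfold resOfLe
  rw [resH1Hom_comp, resH1Hom_comp]
  refine congrArg (fun F : subgroupH1 H₂ S →+ subgroupH1 H₁ M ↦ F d) (resH1Hom_congr ?_ ?_ _ _)
  · ext; rfl
  · ext; rfl

/-- `ι_*` injective `ι` : a class `[z]` with `ι_* [z]` restricting to `0` on `H₁` has `ι ∘ z|_{H₁} = ∂a`. Pure unfolding.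
[cite: SerreGaloisCohomology1997, I.§2.4] -/
theorem resOfLe_resH1Hom_id_oneCocycleClass_eq_zero_iff {H₁ H₂ : Subgroup G} (hle : H₁ ≤ H₂) (ι : S →+ M)
    (hι : ∀ (g : G) (s : S), ι (g • s) = g • ι s) (z : contOneCocycles (discreteTopRep H₂ S)) :
    resOfLe M hle (resH1Hom (ContinuousMonoidHom.id H₂) ι (fun x s ↦ hι x s) (oneCocycleClass _ z)) = 0 ↔
      ∃ a : M, ∀ x : H₁, ι (z.1 (Subgroup.inclusion hle x)) = (x : G) • a - a := by
  rw [resH1Hom_id_oneCocycleClass, CocycleCriteria.resOfLe_oneCocycleClass_eq_zero_iff]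
  rfl

end Cohomology

/-! ## (R1), (R4): the kernel module of a degree-`p` isogeny -/

section KernelModule

open WeierstrassCurve

variable {K : Type u} [Field K] {W W' : WeierstrassCurve K} [W.IsElliptic] (p : ℕ) (ψ : Isogeny W W')
  {S : Type u} [AddCommGroup S] [DistribMulAction (absoluteGaloisGroup K) S] [TopologicalSpace S] [DiscreteTopology S]
  (ι : S →+ ↥(geomPrimaryTorsion W p)) (hι : ∀ (σ : absoluteGaloisGroup K) (s : S), ι (σ • s) = σ • ι s)

omit [W.IsElliptic] in
/-- An element of the kernel of an isogeny of degree `p` is killed by `p` (`#ker ψ = deg ψ = p`, Lagrange).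
[cite: SilvermanAEC2009, Thm. III.4.10 (a)] -/
theorem nsmul_eq_zero_of_isogeny_apply_eq_zero (hdeg : ψ.degree = p) {P : W.geomPoints} (hP : ψ P = 0) :
    p • P = 0 := by
  have hmem : P ∈ ψ.toAddMonoidHom.ker := by rwa [AddMonoidHom.mem_ker, Isogeny.coe_toAddMonoidHom]
  have h : Nat.card ψ.toAddMonoidHom.ker • (⟨P, hmem⟩ : ψ.toAddMonoidHom.ker) = 0 := card_nsmul_eq_zero'
  have hcard : Nat.card ψ.toAddMonoidHom.ker = p := hdeg
  rw [hcard] at h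
  have h' := congrArg (fun y : ψ.toAddMonoidHom.ker ↦ (y : W.geomPoints)) h
  simpa only [AddSubgroupClass.coe_nsmul, ZeroMemClass.coe_zero] using h'

/-- **(R1) cocycle lift.** For an isogeny `ψ : W → W'` of degree `p` and `ι : S ↪ W[p^∞]` injective, equivariant, with image
`ker ψ ∩ W[p^∞]`: every class of `H¹(H, W[p^∞])` killed by `ψ_*` is `ι_*` of a class of `H¹(H, S)`. (On cocycles: `ψ ∘ a = ∂v'`;
`ψ` is surjective on `K̄`-points, `v' = ψ(P)` with `P ∈ W[p^∞]` since `deg ψ = p`; `a − ∂P` is `ker ψ`-valued, so it lifts along `ι`.)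
No `μ = 0`, no duality. [cite: SilvermanAEC2009, Thm. II.2.3, Thm. III.4.10] [cite: SerreGaloisCohomology1997, I.§2.4] -/
theorem exists_resH1Hom_eq_of_h1Map_eq_zero [W'.IsElliptic] (hinj : Function.Injective ι)
    (hsurj : ∀ a : geomPrimaryTorsion W p, ψ (a : W.geomPoints) = 0 → ∃ s : S, ι s = a)
    (hdeg : ψ.degree = p) (H : Subgroup (absoluteGaloisGroup K)) (c : W.subgroupH1 p H)
    (hc : h1Map p H ψ.toAddMonoidHom ψ.equivariant c = 0) :
    ∃ d : subgroupH1 H S, resH1Hom (ContinuousMonoidHom.id H) ι (fun x s ↦ hι x s) d = c := by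
  classical
  obtain ⟨a, rfl⟩ := oneCocycleClass_surjective _ c
  rw [h1Map_oneCocycleClass, oneCocycleClass_eq_zero_iff] at hc
  obtain ⟨v', hv'⟩ := hc
  -- lift `v'` through the surjection `ψ : W(K̄) → W'(K̄)`
  obtain ⟨P, hP⟩ := ψ.surjective (v' : W'.geomPoints)
  obtain ⟨k, hk⟩ := v'.2
  have hPk : p ^ (k + 1) • P = 0 := by
    have hker : ψ (p ^ k • P) = 0 := by
      rw [← Isogeny.coe_toAddMonoidHom, map_nsmul, Isogeny.coe_toAddMonoidHom, hP]
      exact hk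
    rw [pow_succ, mul_comm, mul_smul]
    exact nsmul_eq_zero_of_isogeny_apply_eq_zero p ψ hdeg hker
  let b : geomPrimaryTorsion W p := ⟨P, k + 1, hPk⟩
  have hfb : primaryTorsionMap p ψ.toAddMonoidHom b = v' := Subtype.ext (by
    rw [coe_primaryTorsionMap_apply, Isogeny.coe_toAddMonoidHom]; exact hP)
  -- `a' := a − ∂b` is valued in `ker ψ`
  have hcont : Continuous fun g : H ↦ g • b := by
    change Continuous ((fun σ : absoluteGaloisGroup K ↦ σ • b) ∘ ((↑) : H → absoluteGaloisGroup K))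
    exact (continuous_smul_geomPrimaryTorsion W p b).comp continuous_subtype_val
  set a' : contOneCocycles (discreteTopRep H ↥(geomPrimaryTorsion W p)) := a - cobCocycle b hcont with ha'
  have hval : ∀ x : H, primaryTorsionMap p ψ.toAddMonoidHom (a'.1 x) = 0 := by
    intro x
    have h2 := hv' x
    rw [contOneCocycles.push_apply] at h2
    have e1 : a'.1 x = a.1 x - ((x : absoluteGaloisGroup K) • b - b) := rfl
    rw [e1, map_sub, map_sub, h2, primaryTorsionMap_smul p ψ.toAddMonoidHom ψ.equivariant, hfb]
    exact sub_self _
  have hmem : ∀ x : H, ∃ s : S, ι s = a'.1 x := fun x ↦ hsurj (a'.1 x) (by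
    have h3 := congrArg (fun y : geomPrimaryTorsion W' p ↦ (y : W'.geomPoints)) (hval x)
    simpa [coe_primaryTorsionMap_apply] using h3)
  choose s hs using hmem
  refine ⟨oneCocycleClass _ (contOneCocycles.lift ι (fun x t ↦ hι x t) hinj a' s hs), ?_⟩
  rw [resH1Hom_id_oneCocycleClass, contOneCocycles.push_lift, ha', oneCocycleClass_sub, oneCocycleClass_cobCocycle,
    sub_zero]

variable [NumberField K]

/-- **(R4) unramified away from `p`.** At a place `u ∤ p` of good reduction, a class `d ∈ H¹(H, S)` whose image `ι_* d` is
locally trivial at the chosen place above `u` is unramified there: on `H ⊓ I_u` the cocycle is `ι⁻¹(x • a − a)` with `a ∈ W[p^∞]`,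
and inertia at `u` fixes `W[p^∞]` (Néron–Ogg–Shafarevich VII.4.1 (a), forward direction, tree `smul_eq_of_mem_inertia_of_nsmul_eq_zero`).
[cite: SilvermanAEC2009, Prop. VII.4.1 (a)] [cite: GreenbergVatsal2000, §2 p. 26] -/
theorem mem_unramifiedKer_of_resH1Hom_mem_awayKer (hinj : Function.Injective ι) (H : Subgroup (absoluteGaloisGroup K))
    {u : HeightOneSpectrum (𝓞 K)} (hu : W.HasGoodReductionAt u) (hpu : ((p : ℕ) : 𝓞 K) ∉ u.asIdeal)
    (d : subgroupH1 H S)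
    (hd : resH1Hom (ContinuousMonoidHom.id H) ι (fun x s ↦ hι x s) d ∈ awayKer H ↥(geomPrimaryTorsion W p) u) :
    d ∈ GreenbergVatsal2000.unramifiedKer H S u := by
  obtain ⟨z, rfl⟩ := oneCocycleClass_surjective _ d
  rw [awayKer, AddMonoidHom.mem_ker, resOfLe_resH1Hom_id_oneCocycleClass_eq_zero_iff] at hd
  obtain ⟨a, ha⟩ := hd
  rw [GreenbergVatsal2000.unramifiedKer, AddMonoidHom.mem_ker, CocycleCriteria.resH1Hom_oneCocycleClass_eq_zero_iff]
  refine ⟨0, fun x ↦ ?_⟩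
  rw [smul_zero, sub_zero, AddMonoidHom.id_apply]
  obtain ⟨k, hk⟩ := a.2
  have hx := (mem_inertiaIn_iff H u _).1 x.2
  have hI : ((x : decomp (K := K) u) : absoluteGaloisGroup K) ∈
      (adicCompletionPrime K u).inertia (absoluteGaloisGroup K) := by
    rw [inertia_adicCompletionPrime_eq_map_absInertia]; exact hx.2
  have hn : ((p ^ k : ℕ) : 𝓞 K) ∉ u.asIdeal := fun h ↦ hpu (u.isPrime.mem_of_pow_mem k (by exact_mod_cast h))
  have htriv : ((x : decomp (K := K) u) : absoluteGaloisGroup K) • a = a := Subtype.ext (by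
    rw [primaryComponent.coe_smul]
    exact W.smul_eq_of_mem_inertia_of_nsmul_eq_zero hu hn (adicCompletionPrime_mem_primesAbove K u) hI hk)
  have key := ha ⟨((x : decomp (K := K) u) : absoluteGaloisGroup K), Subgroup.mem_inf.2 ⟨hx.1, (x : decomp u).2⟩⟩
  have key' : ι (z.1 (inertiaInToH H u x)) = 0 := by
    refine key.trans ?_
    change ((x : decomp (K := K) u) : absoluteGaloisGroup K) • a - a = 0
    rw [htriv, sub_self]
  exact hinj (by rw [key', map_zero])

end KernelModule

/-! ## (R2): one place of the cyclotomic tower above the split prime `v̄` -/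

section Generator

/-- **(R2) `Γ_K = I_v̄ · ker κ` for the cyclotomic `ℤ_p`-extension at a split prime.** `K` quadratic, `p = v v̄` split, `κ` cyclotomic:
every `σ ∈ Γ_K` is `τ · h` with `τ` in the inertia group of the chosen prime above `v̄` (so `τ ∈ D_v̄`) and `h ∈ ker κ` — take `τ ∈ I_v̄`
with `χ_p(τ) = χ_p(σ)` (`χ_p(I_v̄) = ℤ_pˣ`, tree `exists_mem_inertia_cyclotomicCharacter_eq_of_split`); then `χ_p(τ⁻¹σ) = 1` is torsion,
i.e. `τ⁻¹σ ∈ ker κ = χ_p⁻¹(μ)`. Hence ONE place of `K_∞` above `v̄` and the `⨅_σ conj_σ` in the Selmer conditions at `v̄` collapses.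
[cite: NeukirchANT1999, Ch. II (7.13)] [cite: Washington1997, §13.1] -/
theorem exists_mem_decomp_inv_mul_mem_kerSubgroup {K : Type} [Field K] [NumberField K] (hK2 : Module.finrank ℚ K = 2)
    {p : ℕ} [Fact p.Prime] {v vbar : HeightOneSpectrum (𝓞 K)} (hpv : ((p : ℕ) : 𝓞 K) ∈ v.asIdeal)
    (hpvbar : ((p : ℕ) : 𝓞 K) ∈ vbar.asIdeal) (hne : vbar ≠ v) (κ : ZpExtension K p) (hκ : κ.IsCyclotomic)
    (σ : absoluteGaloisGroup K) : ∃ d ∈ decomp vbar, d⁻¹ * σ ∈ κ.kerSubgroup := by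
  obtain ⟨τ, hτI, hτχ⟩ := ZpExtension.exists_mem_inertia_cyclotomicCharacter_eq_of_split hK2 hpv hpvbar hne
    (adicCompletionPrime_mem_primesAbove K vbar) (GaloisRep.cyclotomicCharacter K p σ)
  refine ⟨τ, ?_, ?_⟩
  · have hτ' : τ ∈ inertia vbar := by
      rw [inertia_adicCompletionPrime_eq_map_absInertia] at hτI; exact hτI
    exact inertia_le_decomp vbar hτ'
  · rw [hκ]
    refine Subgroup.mem_comap.mpr ?_
    change GaloisRep.cyclotomicCharacter K p (τ⁻¹ * σ) ∈ CommGroup.torsion ℤ_[p]ˣ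
    rw [map_mul, map_inv, hτχ, inv_mul_cancel]
    exact one_mem _

end Generator

/-! ## (R3): the local kernel of `ι_*` is finite, for any closed subgroup -/

section LocalKernel

open WeierstrassCurve

/-- The invariants `A^{G₀}` of a subgroup `G₀` as an additive subgroup. [folklore] -/
def invariants {Γ : Type*} [Group Γ] (A : Type*) [AddCommGroup A] [DistribMulAction Γ A] (G₀ : Subgroup Γ) :
    AddSubgroup A where
  carrier := {a | ∀ x : G₀, (x : Γ) • a = a}
  add_mem' ha hb := fun x ↦ by rw [smul_add, ha x, hb x]
  zero_mem' := fun x ↦ smul_zero _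
  neg_mem' ha := fun x ↦ by rw [smul_neg, ha x]

/-- Unfolding `invariants`. [folklore] -/
theorem mem_invariants_iff {Γ : Type*} [Group Γ] {A : Type*} [AddCommGroup A] [DistribMulAction Γ A] {G₀ : Subgroup Γ}
    {a : A} : a ∈ invariants A G₀ ↔ ∀ x : G₀, (x : Γ) • a = a := Iff.rfl

variable {K : Type u} [Field K] {W W' : WeierstrassCurve K} (p : ℕ) (ψ : Isogeny W W')
  {S : Type u} [AddCommGroup S] [DistribMulAction (absoluteGaloisGroup K) S] [TopologicalSpace S] [DiscreteTopology S]
  (ι : S →+ ↥(geomPrimaryTorsion W p)) (hι : ∀ (σ : absoluteGaloisGroup K) (s : S), ι (σ • s) = σ • ι s)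
  (G₀ : Subgroup (absoluteGaloisGroup K))

omit [DistribMulAction (absoluteGaloisGroup K) S] [TopologicalSpace S] [DiscreteTopology S] in
/-- For `a ∈ W[p^∞]` with `ψ a` `G₀`-invariant, `x • a − a ∈ ker ψ = ι(S)` for `x ∈ G₀`. [folklore] -/
theorem exists_eq_smul_sub (hsurj : ∀ a : geomPrimaryTorsion W p, ψ (a : W.geomPoints) = 0 → ∃ s : S, ι s = a)
    {a : geomPrimaryTorsion W p}
    (ha : primaryTorsionMap p ψ.toAddMonoidHom a ∈ invariants ↥(geomPrimaryTorsion W' p) G₀) (x : G₀) :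
    ∃ s : S, ι s = (x : absoluteGaloisGroup K) • a - a :=
  hsurj _ (by
    have h1 : primaryTorsionMap p ψ.toAddMonoidHom ((x : absoluteGaloisGroup K) • a - a) = 0 := by
      rw [map_sub, primaryTorsionMap_smul p ψ.toAddMonoidHom ψ.equivariant, ha x, sub_self]
    have h3 := congrArg (fun y : geomPrimaryTorsion W' p ↦ (y : W'.geomPoints)) h1
    simpa [coe_primaryTorsionMap_apply] using h3)

/-- **The connecting cocycle** `x ↦ ι⁻¹(x • a − a) : G₀ → S` of an element `a ∈ W[p^∞]` with `ψ a ∈ W'[p^∞]^{G₀}` (the coboundary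
map `W'[p^∞]^{G₀} → H¹(G₀, W[ψ])` of `0 → W[ψ] → W[p^∞] → W'[p^∞] → 0`, evaluated on the lift `a`).
[cite: SerreGaloisCohomology1997, I.§5.4 (connecting map)] [cite: GreenbergLNM1716, §5, proof of Prop. 5.10] -/
def connCocycle (hinj : Function.Injective ι)
    (hsurj : ∀ a : geomPrimaryTorsion W p, ψ (a : W.geomPoints) = 0 → ∃ s : S, ι s = a)
    {a : geomPrimaryTorsion W p} (ha : primaryTorsionMap p ψ.toAddMonoidHom a ∈ invariants ↥(geomPrimaryTorsion W' p) G₀) :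
    contOneCocycles (discreteTopRep G₀ S) :=
  contOneCocycles.lift ι (fun x t ↦ hι x t) hinj
    (cobCocycle a (show Continuous fun g : G₀ ↦ g • a by
      change Continuous ((fun σ : absoluteGaloisGroup K ↦ σ • a) ∘ ((↑) : G₀ → absoluteGaloisGroup K))
      exact (continuous_smul_geomPrimaryTorsion W p a).comp continuous_subtype_val))
    (fun x ↦ (exists_eq_smul_sub p ψ ι G₀ hsurj ha x).choose)
    (fun x ↦ (exists_eq_smul_sub p ψ ι G₀ hsurj ha x).choose_spec)

/-- Values of the connecting cocycle after `ι`. [folklore] -/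
theorem apply_connCocycle (hinj : Function.Injective ι)
    (hsurj : ∀ a : geomPrimaryTorsion W p, ψ (a : W.geomPoints) = 0 → ∃ s : S, ι s = a)
    {a : geomPrimaryTorsion W p} (ha : primaryTorsionMap p ψ.toAddMonoidHom a ∈ invariants ↥(geomPrimaryTorsion W' p) G₀)
    (x : G₀) : ι ((connCocycle p ψ ι hι G₀ hinj hsurj ha).1 x) = (x : absoluteGaloisGroup K) • a - a := by
  rw [connCocycle, contOneCocycles.lift_apply]
  exact (exists_eq_smul_sub p ψ ι G₀ hsurj ha x).choose_spec

/-- **Exactness at `H¹(G₀, W[ψ])`:** a class killed by `ι_*` is a connecting class. [cite: SerreGaloisCohomology1997, I.§5.4 Prop. 38] -/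
theorem exists_connCocycle_eq_of_resH1Hom_eq_zero (hinj : Function.Injective ι)
    (hιψ : ∀ s : S, ψ ((ι s : geomPrimaryTorsion W p) : W.geomPoints) = 0)
    (hsurj : ∀ a : geomPrimaryTorsion W p, ψ (a : W.geomPoints) = 0 → ∃ s : S, ι s = a)
    (f : subgroupH1 G₀ S) (hf : resH1Hom (ContinuousMonoidHom.id G₀) ι (fun x s ↦ hι x s) f = 0) :
    ∃ (a : geomPrimaryTorsion W p) (ha : primaryTorsionMap p ψ.toAddMonoidHom a ∈ invariants ↥(geomPrimaryTorsion W' p) G₀),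
      oneCocycleClass _ (connCocycle p ψ ι hι G₀ hinj hsurj ha) = f := by
  obtain ⟨z, rfl⟩ := oneCocycleClass_surjective _ f
  rw [resH1Hom_id_oneCocycleClass, oneCocycleClass_eq_zero_iff] at hf
  obtain ⟨a, ha⟩ := hf
  have ha' : ∀ x : G₀, ι (z.1 x) = (x : absoluteGaloisGroup K) • a - a := fun x ↦ by
    have h1 := ha x
    rw [contOneCocycles.push_apply] at h1
    exact h1
  have hainv : primaryTorsionMap p ψ.toAddMonoidHom a ∈ invariants ↥(geomPrimaryTorsion W' p) G₀ := by
    intro x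
    have h2 : primaryTorsionMap p ψ.toAddMonoidHom ((x : absoluteGaloisGroup K) • a - a) = 0 := by
      rw [← ha' x]
      exact Subtype.ext (by rw [coe_primaryTorsionMap_apply, Isogeny.coe_toAddMonoidHom]; exact hιψ _)
    rwa [map_sub, primaryTorsionMap_smul p ψ.toAddMonoidHom ψ.equivariant, sub_eq_zero] at h2
  refine ⟨a, hainv, congrArg (oneCocycleClass _) (Subtype.ext (ContinuousMap.ext fun x ↦ hinj ?_))⟩
  rw [apply_connCocycle, ha' x]

/-- **Two lifts with the same image in `W'[p^∞]^{G₀} / ψ(W[p^∞]^{G₀})` give the same connecting class**: if `ψ a₂ = ψ a₁ + ψ b`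
with `b` invariant then `a₂ = a₁ + b + ι s₀` and the cocycles differ by `∂ s₀`. [cite: SerreGaloisCohomology1997, I.§5.4] -/
theorem connClass_eq_of_eq_add (hinj : Function.Injective ι)
    (hsurj : ∀ a : geomPrimaryTorsion W p, ψ (a : W.geomPoints) = 0 → ∃ s : S, ι s = a)
    {a₁ a₂ b : geomPrimaryTorsion W p}
    (ha₁ : primaryTorsionMap p ψ.toAddMonoidHom a₁ ∈ invariants ↥(geomPrimaryTorsion W' p) G₀)
    (ha₂ : primaryTorsionMap p ψ.toAddMonoidHom a₂ ∈ invariants ↥(geomPrimaryTorsion W' p) G₀)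
    (hb : b ∈ invariants ↥(geomPrimaryTorsion W p) G₀)
    (h : primaryTorsionMap p ψ.toAddMonoidHom a₂ = primaryTorsionMap p ψ.toAddMonoidHom a₁ + primaryTorsionMap p ψ.toAddMonoidHom b) :
    oneCocycleClass _ (connCocycle p ψ ι hι G₀ hinj hsurj ha₁) = oneCocycleClass _ (connCocycle p ψ ι hι G₀ hinj hsurj ha₂) := by
  -- `a₂ - a₁ - b ∈ ker ψ = ι(S)`
  obtain ⟨s₀, hs₀⟩ := hsurj (a₂ - a₁ - b) (by
    have h1 : primaryTorsionMap p ψ.toAddMonoidHom (a₂ - a₁ - b) = 0 := by rw [map_sub, map_sub, h]; abel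
    have h3 := congrArg (fun y : geomPrimaryTorsion W' p ↦ (y : W'.geomPoints)) h1
    simpa [coe_primaryTorsionMap_apply] using h3)
  rw [eq_comm, ← sub_eq_zero, ← oneCocycleClass_sub, oneCocycleClass_eq_zero_iff]
  refine ⟨s₀, fun x ↦ hinj ?_⟩
  change ι ((connCocycle p ψ ι hι G₀ hinj hsurj ha₂).1 x - (connCocycle p ψ ι hι G₀ hinj hsurj ha₁).1 x) = ι (x • s₀ - s₀)
  rw [map_sub, map_sub, apply_connCocycle, apply_connCocycle]
  have hb' := hb x
  have hxs : ι (x • s₀) = (x : absoluteGaloisGroup K) • (a₂ - a₁ - b) := by rw [← hs₀]; exact hι x s₀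
  rw [hxs, hs₀, smul_sub, smul_sub, hb']
  abel

/-- **(R3) the local kernel over `v̄` is finite.** For ANY subgroup `G₀ ≤ Γ_K` (intended: `G₀ = ker κ ⊓ D_v̄`), the kernel of
`ι_* : H¹(G₀, W[ψ]) → H¹(G₀, W[p^∞])` is finite: it is the image of `W'[p^∞]^{G₀}` under the connecting map, which factors through
`W'[p^∞]^{G₀} / (ψ(W[p^∞]^{G₀}) ∩ W'[p^∞]^{G₀})`, finite by (R3-alg) (`finiteIndex_map_inf_of_comp_eq_nsmul` with the dual isogeny
`ψ̂`, `ψ̂ψ = [p]`; `W'[p]` finite). NO appeal to Imai's theorem, no `μ`. [cite: GreenbergLNM1716, §5, proof of Prop. 5.10]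
[cite: SilvermanAEC2009, Thm. III.6.1 (a), Cor. III.6.4] -/
theorem finite_ker_resH1Hom_id [NumberField K] [hp : Fact p.Prime] [W.IsElliptic] [W'.IsElliptic]
    (hinj : Function.Injective ι)
    (hιψ : ∀ s : S, ψ ((ι s : geomPrimaryTorsion W p) : W.geomPoints) = 0)
    (hsurj : ∀ a : geomPrimaryTorsion W p, ψ (a : W.geomPoints) = 0 → ∃ s : S, ι s = a) (hdeg : ψ.degree = p) :
    {f : subgroupH1 G₀ S | resH1Hom (ContinuousMonoidHom.id G₀) ι (fun x s ↦ hι x s) f = 0}.Finite := by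
  classical
  -- the dual isogeny and (R3-alg)
  obtain ⟨χ, hχ⟩ := Isogeny.exists_dual_holds_of_isElliptic (W := W) (W' := W') ψ
  set g : ↥(geomPrimaryTorsion W p) →+ ↥(geomPrimaryTorsion W' p) := primaryTorsionMap p ψ.toAddMonoidHom with hg
  set gd : ↥(geomPrimaryTorsion W' p) →+ ↥(geomPrimaryTorsion W p) := primaryTorsionMap p χ.toAddMonoidHom with hgd
  have hcomp : ∀ a' : geomPrimaryTorsion W' p, g (gd a') = p • a' := by
    intro a'
    obtain ⟨Q, hQ⟩ := ψ.surjective (a' : W'.geomPoints)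
    apply Subtype.ext
    rw [hg, hgd, coe_primaryTorsionMap_apply, coe_primaryTorsionMap_apply, AddSubgroupClass.coe_nsmul, ← hQ,
      Isogeny.coe_toAddMonoidHom, Isogeny.coe_toAddMonoidHom, hχ, hdeg, natCast_zsmul, ← Isogeny.coe_toAddMonoidHom,
      map_nsmul]
  have hprim : ∀ a' : geomPrimaryTorsion W' p, ∃ k : ℕ, p ^ k • a' = 0 := fun a' ↦ by
    obtain ⟨k, hk⟩ := a'.2
    exact ⟨k, Subtype.ext (by rw [AddSubgroupClass.coe_nsmul]; exact hk)⟩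
  have hfin := finite_torsionBy_addSubgroup (p := p) (geomPrimaryTorsion W' p)
    (W'.finite_geomTorsion (m := (p : ℤ)) (by exact_mod_cast hp.out.ne_zero))
  set A₀ := invariants ↥(geomPrimaryTorsion W p) G₀ with hA₀
  set A'₀ := invariants ↥(geomPrimaryTorsion W' p) G₀ with hA'₀
  have hgdinv : ∀ a' ∈ A'₀, gd a' ∈ A₀ := fun a' ha' x ↦ by
    rw [hgd, ← primaryTorsionMap_smul p χ.toAddMonoidHom χ.equivariant, ha' x]
  haveI hFI := finiteIndex_map_inf_of_comp_eq_nsmul g gd hcomp hprim hfin A₀ A'₀ hgdinv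
  -- the connecting classes, indexed by lifts, have finitely many values
  let L : Type u := {a : geomPrimaryTorsion W p // g a ∈ A'₀}
  let q : L → A'₀ ⧸ (A₀.map g ⊓ A'₀).addSubgroupOf A'₀ := fun a ↦ QuotientAddGroup.mk ⟨g a, a.2⟩
  let C : L → subgroupH1 G₀ S := fun a ↦ oneCocycleClass _ (connCocycle p ψ ι hι G₀ hinj hsurj a.2)
  have hC : (Set.range C).Finite := by
    have hsub : Set.range C ⊆ ⋃ y, C '' (q ⁻¹' {y}) := by
      rintro _ ⟨a, rfl⟩
      exact Set.mem_iUnion.2 ⟨q a, Set.mem_image_of_mem C rfl⟩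
    refine (Set.finite_iUnion fun y ↦ Set.Subsingleton.finite ?_).subset hsub
    rintro _ ⟨a₁, ha₁, rfl⟩ _ ⟨a₂, ha₂, rfl⟩
    have h12 : q a₁ = q a₂ := (ha₁ : q a₁ = y).trans (ha₂ : q a₂ = y).symm
    have hmem := (QuotientAddGroup.eq (s := (A₀.map g ⊓ A'₀).addSubgroupOf A'₀)).1 h12
    rw [AddSubgroup.mem_addSubgroupOf, AddSubgroup.mem_inf] at hmem
    obtain ⟨⟨b, hb, hgb⟩, -⟩ := hmem
    refine connClass_eq_of_eq_add p ψ ι hι G₀ hinj hsurj a₁.2 a₂.2 hb ?_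
    change g a₂ = g a₁ + g b
    rw [hgb]
    change g a₂ = g a₁ + (-g a₁ + g a₂)
    abel
  refine hC.subset fun f hf ↦ ?_
  obtain ⟨a, ha, h⟩ := exists_connCocycle_eq_of_resH1Hom_eq_zero p ψ ι hι G₀ hinj hιψ hsurj f hf
  exact ⟨⟨a, ha⟩, h⟩

end LocalKernel

end Summit.BirchSwinnertonDyer.BirchSwinnertonDyer.Theorems.InterludeWithTorsion.RoadBHelpers

end
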